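import Mathlib.Analysis.SpecialFunctions.SmoothTransition
import Mathlib.Analysis.InnerProductSpace.Calculus
import Mathlib.Analysis.Calculus.FDeriv.Symmetric
import Mathlib.Topology.MetricSpace.ProperSpace
import HarnessLib

/-!
# Breathing deformations of a vector space: a one-parameter family of compactly supported
# perturbations of the identity with prescribed differential at a point

Topic `Literature/Geometry/Manifold` (namespace `Literature.Geometry.Manifold.Breathing`). On a
real inner product space `F`, for a centre `z₀` and a radius `r > 0`, we construct the explicit
family

  `φ s z = z + s • g z`,  `g z = β(‖z − z₀‖² / r²) • (z − z₀)`,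

where `β = 1 − smoothTransition (4u − 1)` is a smooth cut-off equal to `1` for `u ≤ 1/4` and to
`0` for `u ≥ 1/2` (Mathlib's `Real.smoothTransition`). Properties (all PROVED):

* `contDiff_uncurry_phi` — `(s, z) ↦ φ s z` is `C^∞` jointly; `phi_zero` — `φ 0 = id`;
* `phi_apply_center`, `fderiv_phi_center` — `φ s z₀ = z₀` and `dφ_s(z₀) = (1 + s) • id`
  (**breathing**: near `z₀` the map is the homothety of ratio `1 + s` centred at `z₀`);
* `phi_eq_self_of` — `φ s z = z` whenever `r²/2 ≤ ‖z − z₀‖²`, in particular off the closed ball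
  `closedBall z₀ r`; `dist_phi_center_lt` — `φ s` maps `ball z₀ r` into `ball z₀ ((1 + |s|) r)`;
* `exists_forall_injective_fderiv_phi` — **for `|s|` small all differentials `dφ_s(z)` are
  injective**: `dφ_s = id + s • dg` with `dg` continuous and compactly supported, hence bounded
  by some `B`, and `‖v + s dg v‖ ≥ (1 − |s| B)‖v‖`.

This is the local model of the "breathing diffeomorphism" marker used to make a one-parameter
family of pulled-back tensors injective in the parameter (compare `ConstraintFamilies.lean`, where
a `3`-parameter version on a chart domain of `ℝ³` serves Christodoulou's codimension counts): the
pulled-back metric at `z₀` is `(1 + s)² h_{z₀}`. Standard differential topology (Lee 2013, Ch. 2,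
bump functions; the isotopy `z ↦ z + s g(z)` of a compactly supported field).

## References

* J. M. Lee, *Introduction to Smooth Manifolds*, 2nd ed. (2013), Ch. 2 (bump functions),
  Prop. 2.25. [LeeSmoothManifolds2013]
-/

noncomputable section

open Set Metric Filter Function
open scoped Topology ContDiff

namespace Literature.Geometry.Manifold.Breathing

variable {F : Type*} [NormedAddCommGroup F] [InnerProductSpace ℝ F]

/-! ### The cut-off -/

/-- The cut-off profile `β u = 1 − smoothTransition (4u − 1)`: smooth, `= 1` for `u ≤ 1/4`, `= 0`
for `u ≥ 1/2`, values in `[0, 1]`. [folklore] -/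
def beta (u : ℝ) : ℝ := 1 - Real.smoothTransition (4 * u - 1)

/-- `β` is smooth. [folklore] -/
theorem contDiff_beta {n : ℕ∞} : ContDiff ℝ n beta :=
  contDiff_const.sub (Real.smoothTransition.contDiff.comp
    ((contDiff_const.mul contDiff_id).sub contDiff_const))

/-- `β u = 1` for `u ≤ 1/4`. [folklore] -/
theorem beta_of_le {u : ℝ} (hu : u ≤ 1 / 4) : beta u = 1 := by
  rw [beta, Real.smoothTransition.zero_of_nonpos (by linarith), sub_zero]

/-- `β u = 0` for `1/2 ≤ u`. [folklore] -/
theorem beta_of_ge {u : ℝ} (hu : 1 / 2 ≤ u) : beta u = 0 := by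
  rw [beta, Real.smoothTransition.one_of_one_le (by linarith), sub_self]

/-- `0 ≤ β u`. [folklore] -/
theorem beta_nonneg (u : ℝ) : 0 ≤ beta u := by
  rw [beta, sub_nonneg]; exact Real.smoothTransition.le_one _

/-- `β u ≤ 1`. [folklore] -/
theorem beta_le_one (u : ℝ) : beta u ≤ 1 := by
  rw [beta, sub_le_self_iff]; exact Real.smoothTransition.nonneg _

/-! ### The compactly supported field `g` and the deformation `φ` -/

/-- The compactly supported field `g z = β(‖z − z₀‖²/r²) • (z − z₀)`. [folklore] -/
def gField (z₀ : F) (r : ℝ) (z : F) : F := beta (‖z - z₀‖ ^ 2 / r ^ 2) • (z - z₀)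

/-- The **breathing deformation** `φ s z = z + s • g z`. [cite: LeeSmoothManifolds2013, Prop. 2.25] -/
def phi (z₀ : F) (r : ℝ) (s : ℝ) (z : F) : F := z + s • gField z₀ r z

variable (z₀ : F) (r : ℝ)

/-- `g` is smooth. [folklore] -/
theorem contDiff_gField {n : ℕ∞} : ContDiff ℝ n (gField z₀ r) := by
  unfold gField
  refine ContDiff.smul ?_ (contDiff_id.sub contDiff_const)
  exact contDiff_beta.comp (((contDiff_id.sub contDiff_const).norm_sq ℝ).div_const _)

/-- `(s, z) ↦ φ s z` is smooth jointly. [cite: LeeSmoothManifolds2013, Prop. 2.25] -/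
theorem contDiff_uncurry_phi {n : ℕ∞} : ContDiff ℝ n (uncurry (phi z₀ r)) := by
  have h1 : ContDiff ℝ n (fun p : ℝ × F ↦ p.2) := contDiff_snd
  have h2 : ContDiff ℝ n (fun p : ℝ × F ↦ p.1 • gField z₀ r p.2) :=
    contDiff_fst.smul ((contDiff_gField z₀ r).comp contDiff_snd)
  exact h1.add h2

/-- Each `φ s` is smooth. [cite: LeeSmoothManifolds2013, Prop. 2.25] -/
theorem contDiff_phi (s : ℝ) {n : ℕ∞} : ContDiff ℝ n (phi z₀ r s) :=
  contDiff_id.add (contDiff_const.smul (contDiff_gField z₀ r))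

/-- `φ 0 = id`. [folklore] -/
@[simp] theorem phi_zero : phi z₀ r 0 = id := by
  funext z; simp [phi]

/-- `g z₀ = 0`. [folklore] -/
@[simp] theorem gField_center : gField z₀ r z₀ = 0 := by simp [gField]

/-- `φ s z₀ = z₀`: the centre is fixed. [folklore] -/
@[simp] theorem phi_apply_center (s : ℝ) : phi z₀ r s z₀ = z₀ := by simp [phi]

/-- `g z = 0` whenever `r²/2 ≤ ‖z − z₀‖²` (in particular for `r ≤ ‖z − z₀‖`, `r > 0`). [folklore] -/
theorem gField_eq_zero_of {z : F} (hr : 0 < r) (hz : r ^ 2 / 2 ≤ ‖z - z₀‖ ^ 2) : gField z₀ r z = 0 := by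
  unfold gField
  rw [beta_of_ge, zero_smul]
  rw [le_div_iff₀ (pow_pos hr 2)]
  linarith

/-- `φ s z = z` whenever `r²/2 ≤ ‖z − z₀‖²`. [folklore] -/
theorem phi_eq_self_of {z : F} (hr : 0 < r) (hz : r ^ 2 / 2 ≤ ‖z - z₀‖ ^ 2) (s : ℝ) :
    phi z₀ r s z = z := by
  rw [phi, gField_eq_zero_of z₀ r hr hz, smul_zero, add_zero]

/-- `φ s z = z` off the open ball `ball z₀ r` (for `r > 0`). [folklore] -/
theorem phi_eq_self_of_not_mem_ball {z : F} (hr : 0 < r) (hz : z ∉ ball z₀ r) (s : ℝ) :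
    phi z₀ r s z = z := by
  refine phi_eq_self_of z₀ r hr ?_ s
  rw [mem_ball, dist_eq_norm, not_lt] at hz
  have h : r ^ 2 ≤ ‖z - z₀‖ ^ 2 := pow_le_pow_left₀ hr.le hz 2
  linarith [pow_pos hr 2]

/-- `‖g z‖ ≤ ‖z − z₀‖` (`0 ≤ β ≤ 1`). [folklore] -/
theorem norm_gField_le (z : F) : ‖gField z₀ r z‖ ≤ ‖z - z₀‖ := by
  rw [gField, norm_smul, Real.norm_of_nonneg (beta_nonneg _)]
  exact mul_le_of_le_one_left (norm_nonneg _) (beta_le_one _)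

/-- `‖φ s z − z₀‖ ≤ (1 + |s|) ‖z − z₀‖`. [folklore] -/
theorem norm_phi_sub_center_le (s : ℝ) (z : F) : ‖phi z₀ r s z - z₀‖ ≤ (1 + |s|) * ‖z - z₀‖ := by
  have h : phi z₀ r s z - z₀ = (z - z₀) + s • gField z₀ r z := by
    rw [phi]; abel
  rw [h]
  refine (norm_add_le _ _).trans ?_
  rw [norm_smul, Real.norm_eq_abs, add_mul, one_mul]
  exact add_le_add le_rfl (mul_le_mul_of_nonneg_left (norm_gField_le z₀ r z) (abs_nonneg s))

/-- `φ s` maps `ball z₀ r` into `ball z₀ ((1 + |s|) r)`. [folklore] -/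
theorem phi_mem_ball {z : F} (hz : z ∈ ball z₀ r) (s : ℝ) :
    phi z₀ r s z ∈ ball z₀ ((1 + |s|) * r) := by
  rw [mem_ball, dist_eq_norm] at hz ⊢
  refine lt_of_le_of_lt (norm_phi_sub_center_le z₀ r s z) ?_
  exact mul_lt_mul_of_pos_left hz (by positivity)

/-! ### Differentials -/

/-- `g z = z − z₀` near `z₀` (where `β = 1`), for `r > 0`. [folklore] -/
theorem gField_eventuallyEq_sub (hr : 0 < r) : gField z₀ r =ᶠ[𝓝 z₀] fun z ↦ z - z₀ := by
  have hmem : ball z₀ (r / 2) ∈ 𝓝 z₀ := ball_mem_nhds z₀ (by positivity)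
  filter_upwards [hmem] with z hz
  rw [mem_ball, dist_eq_norm] at hz
  unfold gField
  rw [beta_of_le, one_smul]
  rw [div_le_iff₀ (pow_pos hr 2)]
  have h : ‖z - z₀‖ ^ 2 ≤ (r / 2) ^ 2 := pow_le_pow_left₀ (norm_nonneg _) hz.le 2
  linarith

/-- `dg(z₀) = id`. [folklore] -/
theorem fderiv_gField_center (hr : 0 < r) : fderiv ℝ (gField z₀ r) z₀ = ContinuousLinearMap.id ℝ F := by
  rw [(gField_eventuallyEq_sub z₀ r hr).fderiv_eq]
  have h : (fun z : F ↦ z - z₀) = fun z ↦ id z - z₀ := rfl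
  rw [h, fderiv_sub_const, fderiv_id]

/-- **`dφ_s(z) = id + s • dg(z)`.** [folklore] -/
theorem fderiv_phi (s : ℝ) (z : F) :
    fderiv ℝ (phi z₀ r s) z = ContinuousLinearMap.id ℝ F + s • fderiv ℝ (gField z₀ r) z := by
  have hg : DifferentiableAt ℝ (gField z₀ r) z := (contDiff_gField z₀ r (n := 1)).differentiable one_ne_zero z
  have h : HasFDerivAt (phi z₀ r s)
      (ContinuousLinearMap.id ℝ F + s • fderiv ℝ (gField z₀ r) z) z :=
    (hasFDerivAt_id z).add (hg.hasFDerivAt.const_smul s)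
  exact h.fderiv

/-- **Breathing at the centre**: `dφ_s(z₀) = (1 + s) • id`. [cite: LeeSmoothManifolds2013, Prop. 2.25] -/
theorem fderiv_phi_center (hr : 0 < r) (s : ℝ) :
    fderiv ℝ (phi z₀ r s) z₀ = (1 + s) • ContinuousLinearMap.id ℝ F := by
  rw [fderiv_phi, fderiv_gField_center z₀ r hr, add_smul, one_smul]

/-- `dg` vanishes off the closed ball `closedBall z₀ r` (indeed wherever `r²/2 < ‖z − z₀‖²`), for
`r > 0`. [folklore] -/
theorem fderiv_gField_eq_zero_of_not_mem {z : F} (hr : 0 < r) (hz : z ∉ closedBall z₀ r) :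
    fderiv ℝ (gField z₀ r) z = 0 := by
  have hev : gField z₀ r =ᶠ[𝓝 z] fun _ ↦ (0 : F) := by
    rw [mem_closedBall, dist_eq_norm, not_le] at hz
    have hopen : IsOpen {w : F | r < ‖w - z₀‖} := isOpen_lt continuous_const (continuous_id.sub continuous_const).norm
    filter_upwards [hopen.mem_nhds hz] with w hw
    refine gField_eq_zero_of z₀ r hr ?_
    have h : r ^ 2 ≤ ‖w - z₀‖ ^ 2 := pow_le_pow_left₀ hr.le (le_of_lt hw) 2
    linarith [pow_pos hr 2]
  rw [hev.fderiv_eq, fderiv_fun_const]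
  rfl

/-- **`dg` is bounded**: continuous and compactly supported (finite-dimensional `F`). [folklore] -/
theorem exists_bound_fderiv_gField [FiniteDimensional ℝ F] (hr : 0 < r) :
    ∃ B : ℝ, 0 ≤ B ∧ ∀ z : F, ‖fderiv ℝ (gField z₀ r) z‖ ≤ B := by
  have hcont : Continuous (fderiv ℝ (gField z₀ r)) :=
    (contDiff_gField z₀ r (n := 1)).continuous_fderiv one_ne_zero
  haveI : ProperSpace F := FiniteDimensional.proper ℝ F
  obtain ⟨B, hB⟩ := (isCompact_closedBall z₀ r).exists_bound_of_continuousOn hcont.continuousOn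
  refine ⟨max B 0, le_max_right _ _, fun z ↦ ?_⟩
  by_cases hz : z ∈ closedBall z₀ r
  · exact (hB z hz).trans (le_max_left _ _)
  · rw [fderiv_gField_eq_zero_of_not_mem z₀ r hr hz, norm_zero]
    exact le_max_right _ _

/-- **For small `|s|` all differentials of `φ s` are injective**: with `‖dg‖ ≤ B`,
`‖dφ_s(z) v‖ ≥ ‖v‖ − |s| B ‖v‖ > 0` for `v ≠ 0` and `|s| < (B + 1)⁻¹`. [cite: LeeSmoothManifolds2013, Prop. 2.25] -/
theorem exists_forall_injective_fderiv_phi [FiniteDimensional ℝ F] (hr : 0 < r) :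
    ∃ s₀ : ℝ, 0 < s₀ ∧ ∀ s : ℝ, |s| < s₀ → ∀ z : F, Injective (fderiv ℝ (phi z₀ r s) z) := by
  obtain ⟨B, hB0, hB⟩ := exists_bound_fderiv_gField z₀ r hr
  refine ⟨(B + 1)⁻¹, by positivity, fun s hs z ↦ ?_⟩
  rw [fderiv_phi]
  intro v w hvw
  rw [← sub_eq_zero]
  set u := v - w with hu
  have h : (ContinuousLinearMap.id ℝ F + s • fderiv ℝ (gField z₀ r) z) u = 0 := by
    rw [hu, map_sub, sub_eq_zero]
    exact hvw
  simp only [add_apply, ContinuousLinearMap.id_apply,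
    FunLike.coe_smul, Pi.smul_apply] at h
  -- `‖u‖ = ‖s • dg u‖ ≤ |s| B ‖u‖ < ‖u‖` unless `u = 0`
  by_contra hne
  have hupos : 0 < ‖u‖ := norm_pos_iff.2 hne
  have h1 : ‖u‖ = ‖s • fderiv ℝ (gField z₀ r) z u‖ := by
    have : u = -(s • fderiv ℝ (gField z₀ r) z u) := eq_neg_of_add_eq_zero_left h
    conv_lhs => rw [this]
    rw [norm_neg]
  have h2 : ‖s • fderiv ℝ (gField z₀ r) z u‖ ≤ |s| * (B * ‖u‖) := by
    rw [norm_smul, Real.norm_eq_abs]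
    exact mul_le_mul_of_nonneg_left ((ContinuousLinearMap.le_opNorm _ _).trans
      (mul_le_mul_of_nonneg_right (hB z) (norm_nonneg _))) (abs_nonneg s)
  have hs' : |s| * (B + 1) < 1 := by
    have h := mul_lt_mul_of_pos_right hs (by positivity : (0 : ℝ) < B + 1)
    rwa [inv_mul_cancel₀ (by positivity : (B : ℝ) + 1 ≠ 0)] at h
  have h3 : |s| * (B * ‖u‖) < ‖u‖ := by
    have h4 : |s| * (B * ‖u‖) ≤ |s| * ((B + 1) * ‖u‖) :=
      mul_le_mul_of_nonneg_left (mul_le_mul_of_nonneg_right (by linarith) hupos.le) (abs_nonneg s)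
    have h5 : |s| * ((B + 1) * ‖u‖) < 1 * ‖u‖ := by
      rw [← mul_assoc]
      exact mul_lt_mul_of_pos_right hs' hupos
    linarith
  linarith

end Literature.Geometry.Manifold.Breathing

end
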